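import Mathlib
import HarnessLib
import Summits.NavierStokesRegularity.NavierStokesRegularity.Theorems.PoloidalWindowDoorPoloidalWindowRigidityLargeScaleEnergy
import Summits.NavierStokesRegularity.NavierStokesRegularity.Theorems.PoloidalWindowDoorPoloidalWindowRigidityPressureOscillation
import Literature.Analysis.FluidPDE.ClassicalSolutionRescale
import Literature.Analysis.FluidPDE.KNSSTypeIRateMildProofs
import Literature.Analysis.FluidPDE.SelfSimilar

/-!
# Route `PoloidalWindowDoor`, crux `PoloidalWindowRigidity` (K2, stmt-NavierStokesRegularity-19708) —
# THE K2 LEAD'S LARGE-SCALE ENERGY THEOREM, UNCONDITIONALLY: `hBMO` discharged at every radius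

Cell ns-regularity-ideate, seat nsreg-p7 (gen 6, third worker under the K2 lead; `--supports stmt-…-19708`).
`…PressureOscillation.exists_integral_abs_sub_le_class` gives the mean-oscillation bound (F1) for the pressure of
the Type-I mild class on balls of radius `≥ 1`; the class is invariant under the Navier–Stokes scaling
`v ↦ λv(λ²·, λ·)` (`HasTypeITimeDecay.nsRescale`, `oseen_smul_stPull`) and classical pressures rescale as
`p ↦ λ²p(λ²·, λ·)`
(`IsClassicalNSSolutionOn.nsRescale_holds`), so the bound at radius `R < 1` and time `s` is the bound at radius
`1` and time `s/R²` for the rescaled pair (`exists_integral_abs_sub_le_class_allRadii`).  This is literally the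
hypothesis `hBMO` of the K2 lead's `…LargeScaleEnergy.exists_largeScale_energy_bound` (K2-p1 g2, p488864), which
therefore holds UNCONDITIONALLY for the class (`largeScale_energy_bound`):

  `∃ K ≥ 0, ∀ t < 0, ∀ R ≥ 1:  ∫_{B̄(0,R)} |v(t)|² ≤ K · (1/(−t) + 1 + 1/√(−t)) / R · |B̄(0,R)|`.

WHAT THIS IS NOT: not a claim about Navier–Stokes regularity and not the open residue S2⁗ — the lead's whole-class
averaged spatial-decay theorem with its only hypothesis removed (bears_on LADDER-NS N0 via crux K2 = stmt-19708).
-/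

noncomputable section

-- the summit and its single sub-problem share the name (CONVENTIONS §1), as in every Theorems file
set_option linter.dupNamespace false

namespace Summit.NavierStokesRegularity.NavierStokesRegularity.Theorems.PoloidalWindowDoorPoloidalWindowRigidityLargeScaleEnergyHolds

open MeasureTheory Set Function Filter Topology Metric InnerProductSpace
open scoped RealInnerProductSpace Laplacian ContDiff Pointwise
open Literature.Analysis Literature.Analysis.FluidPDE Literature.Analysis.UnboundedOperators
open Summit.NavierStokesRegularity.NavierStokesRegularity.Theorems.PoloidalWindowDoorPoloidalWindowRigidityPressureOscillation
open Summit.NavierStokesRegularity.NavierStokesRegularity.Theorems.PoloidalWindowDoorPoloidalWindowRigidityLargeScaleEnergy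

/-- The route's class hypotheses (Type-I rate and Oseen-mild identity between negative times) are invariant
under the Navier–Stokes scaling `v ↦ c v(c²·, c·)`, `c > 0` (`HasTypeITimeDecay.nsRescale`; the mild identity
by the zoom covariance `oseen_smul_stPull` of KNSS 2009 §1, `nsRescale c v = c • stPull c² c 0 0 v`). -/
theorem mild_nsRescale {v : ℝ → EuclideanSpace ℝ (Fin 3) → EuclideanSpace ℝ (Fin 3)}
    (hmild : ∀ s t : ℝ, s < t → t < 0 → ∀ x,
      v t x = heatExtension (v s) (t - s) x - oseenDuhamel 1 s v v t x) {c : ℝ} (hc : 0 < c) :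
    ∀ s t : ℝ, s < t → t < 0 → ∀ x,
      nsRescale c v t x = heatExtension (nsRescale c v s) (t - s) x -
        oseenDuhamel 1 s (nsRescale c v) (nsRescale c v) t x := by
  intro s t hst ht x
  have hc2 : 0 < c ^ 2 := pow_pos hc 2
  have hst' : (0 : ℝ) + c ^ 2 * s < 0 + c ^ 2 * t := by nlinarith
  have ht' : (0 : ℝ) + c ^ 2 * t < 0 := by nlinarith
  have hu : ∀ X, v (0 + c ^ 2 * t) X = heatExtension (v (0 + c ^ 2 * s)) (0 + c ^ 2 * t - (0 + c ^ 2 * s)) X -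
      oseenDuhamel 1 (0 + c ^ 2 * s) v v (0 + c ^ 2 * t) X := fun X =>
    hmild (0 + c ^ 2 * s) (0 + c ^ 2 * t) hst' ht' X
  have e : nsRescale c v = c • stPull (c ^ 2) c 0 (0 : EuclideanSpace ℝ (Fin 3)) v := by
    funext σ y
    simp only [nsRescale_apply, Pi.smul_apply, stPull_apply, zero_add]
  rw [e]
  exact oseen_smul_stPull hc 0 (0 : EuclideanSpace ℝ (Fin 3)) hst hu x

/-- **(F1) at every radius.** There is a universal `K` such that for every field `v` of the route's class (Type-I
rate `C`, Oseen-mild between negative times), every classical pressure `p` on a window `(t₀,0)`, `s ∈ (t₀,0)` and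
`R > 0`, there is
`κ` with `∫_{B̄(0,R)} |p(s,x) − κ| dx ≤ K · C²/(−s) · |B̄(0,R)|`: radii `≥ 1` by
`exists_integral_abs_sub_le_class`, radii `< 1` by the Navier–Stokes rescaling `λ = R`. [folklore] -/
theorem exists_integral_abs_sub_le_class_allRadii :
    ∃ K : ℝ, 0 ≤ K ∧ ∀ {C : ℝ} {v : ℝ → EuclideanSpace ℝ (Fin 3) → EuclideanSpace ℝ (Fin 3)}
      {p : ℝ → EuclideanSpace ℝ (Fin 3) → ℝ} {t₀ : ℝ},
      HasTypeITimeDecay C v →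
      (∀ s t : ℝ, s < t → t < 0 → ∀ x, v t x = heatExtension (v s) (t - s) x - oseenDuhamel 1 s v v t x) →
      t₀ < 0 → IsClassicalNSSolutionOn (Ioo t₀ 0) 1 0 v p →
      ∀ s, t₀ < s → s < 0 → ∀ R : ℝ, 0 < R →
        ∃ κ : ℝ, ∫ x in closedBall (0 : EuclideanSpace ℝ (Fin 3)) R, |p s x - κ| ≤
          K * (C ^ 2 / (-s)) * volume.real (closedBall (0 : EuclideanSpace ℝ (Fin 3)) R) := by
  obtain ⟨K, hK0, hK⟩ := exists_integral_abs_sub_le_class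
  refine ⟨K, hK0, ?_⟩
  intro C v p t₀ hrate hmild ht₀ hcl s hs1 hs2 R hR
  by_cases hR1 : 1 ≤ R
  · exact hK hrate hmild ht₀ hcl s ⟨hs1, hs2⟩ 0 R hR1
  · -- rescale by `λ = R < 1`
    rw [not_le] at hR1
    have hR2 : 0 < R ^ 2 := by positivity
    set w : ℝ → EuclideanSpace ℝ (Fin 3) → EuclideanSpace ℝ (Fin 3) := nsRescale R v with hw
    set q : ℝ → EuclideanSpace ℝ (Fin 3) → ℝ := nsRescalePressure R p with hq
    have hw_rate : HasTypeITimeDecay C w := hrate.nsRescale hR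
    have hw_mild := mild_nsRescale hmild hR
    -- the rescaled classical solution on the window `(t₀/R², 0)`
    have hcl' : IsClassicalNSSolutionOn ((fun t => R ^ 2 * t) ⁻¹' Ioo t₀ 0) 1 (nsRescaleForce R 0) w q :=
      IsClassicalNSSolutionOn.nsRescale_holds hcl hR
    have hset : ((fun t => R ^ 2 * t) ⁻¹' Ioo t₀ 0) = Ioo (t₀ / R ^ 2) 0 := by
      ext t
      simp only [mem_preimage, mem_Ioo]
      constructor
      · rintro ⟨h1, h2⟩
        exact ⟨by rw [div_lt_iff₀ hR2]; linarith, by nlinarith⟩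
      · rintro ⟨h1, h2⟩
        exact ⟨by rw [div_lt_iff₀ hR2] at h1; linarith, by nlinarith⟩
    rw [hset, nsRescaleForce_zero] at hcl'
    have ht₀' : t₀ / R ^ 2 < 0 := div_neg_of_neg_of_pos ht₀ hR2
    -- the rescaled time `s' = s/R²`
    set s' : ℝ := s / R ^ 2 with hs'
    have hs'1 : t₀ / R ^ 2 < s' := by rw [hs']; exact div_lt_div_of_pos_right hs1 hR2
    have hs'2 : s' < 0 := div_neg_of_neg_of_pos hs2 hR2
    have hss : R ^ 2 * s' = s := by rw [hs']; field_simp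
    obtain ⟨κ, hκ⟩ := hK hw_rate hw_mild ht₀' hcl' s' ⟨hs'1, hs'2⟩ 0 1 le_rfl
    refine ⟨κ / R ^ 2, ?_⟩
    -- unfold the rescaled pressure and change variables
    have hq' : ∀ x, q s' x = R ^ 2 * p s (R • x) := fun x => by rw [hq, nsRescalePressure_apply, hss]
    have hint : ∫ x in closedBall (0 : EuclideanSpace ℝ (Fin 3)) 1, |q s' x - κ| =
        R ^ 2 * (R ^ 3)⁻¹ * ∫ y in closedBall (0 : EuclideanSpace ℝ (Fin 3)) R, |p s y - κ / R ^ 2| := by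
      have h1 : ∀ x, |q s' x - κ| = R ^ 2 * (fun y => |p s y - κ / R ^ 2|) (R • x) := by
        intro x
        rw [hq']
        have : R ^ 2 * p s (R • x) - κ = R ^ 2 * (p s (R • x) - κ / R ^ 2) := by field_simp
        rw [this, abs_mul, abs_of_pos hR2]
      simp_rw [h1]
      rw [integral_const_mul, Measure.setIntegral_comp_smul_of_pos volume (fun y => |p s y - κ / R ^ 2|)
        (closedBall (0 : EuclideanSpace ℝ (Fin 3)) 1) hR, finrank_euclideanSpace_fin, smul_unitClosedBall,
        Real.norm_of_nonneg hR.le, smul_eq_mul, mul_assoc]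
    have hvol1 : volume.real (closedBall (0 : EuclideanSpace ℝ (Fin 3)) R) =
        R ^ 3 * volume.real (closedBall (0 : EuclideanSpace ℝ (Fin 3)) 1) := by
      rw [measureReal_def, measureReal_def,
        Measure.addHaar_closedBall' volume (0 : EuclideanSpace ℝ (Fin 3)) hR.le,
        finrank_euclideanSpace_fin, ENNReal.toReal_mul, ENNReal.toReal_ofReal (by positivity)]
    -- `R²·R⁻³ ∫_{B̄_R} |p − κ'| ≤ K C²/(−s') |B̄_1|` and `−s' = −s/R²`
    have hs'neg : -s' = -s / R ^ 2 := by rw [hs']; ring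
    rw [hint, hs'neg] at hκ
    rw [hvol1]
    have hsne : 0 < -s := by linarith
    have h := mul_le_mul_of_nonneg_left hκ (by positivity : (0 : ℝ) ≤ R ^ 3 / R ^ 2)
    have hRR : R ^ 3 / R ^ 2 * (R ^ 2 * (R ^ 3)⁻¹) = 1 := by field_simp
    calc ∫ y in closedBall (0 : EuclideanSpace ℝ (Fin 3)) R, |p s y - κ / R ^ 2|
        = R ^ 3 / R ^ 2 * (R ^ 2 * (R ^ 3)⁻¹ *
            ∫ y in closedBall (0 : EuclideanSpace ℝ (Fin 3)) R, |p s y - κ / R ^ 2|) := by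
          rw [← mul_assoc, hRR, one_mul]
      _ ≤ R ^ 3 / R ^ 2 * (K * (C ^ 2 / (-s / R ^ 2)) *
            volume.real (closedBall (0 : EuclideanSpace ℝ (Fin 3)) 1)) := h
      _ = K * (C ^ 2 / (-s)) * (R ^ 3 * volume.real (closedBall (0 : EuclideanSpace ℝ (Fin 3)) 1)) := by
          field_simp

variable {C : ℝ} {v : ℝ → EuclideanSpace ℝ (Fin 3) → EuclideanSpace ℝ (Fin 3)}

/-- **THE K2 LEAD'S LARGE-SCALE ENERGY DECAY, UNCONDITIONAL.** For a profile of the route's Type-I class there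
is `K ≥ 0` with `∫_{B̄(0,R)} |v(t)|² ≤ K (1/(−t) + 1 + 1/√(−t))/R · |B̄(0,R)|` for all `t < 0`, `R ≥ 1`
(`…LargeScaleEnergy.exists_largeScale_energy_bound` with its hypothesis `hBMO` supplied by
`exists_integral_abs_sub_le_class_allRadii`). -/
theorem largeScale_energy_bound (hrate : HasTypeITimeDecay C v)
    (hcont : ContinuousOn (uncurry v) (Iio (0 : ℝ) ×ˢ univ))
    (hmild : ∀ s t : ℝ, s < t → t < 0 → ∀ x,
      v t x = heatExtension (v s) (t - s) x - oseenDuhamel 1 s v v t x)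
    (hdiv : ∀ t < 0, VectorCalculus.IsDivFree (v t)) :
    ∃ K : ℝ, 0 ≤ K ∧ ∀ t < 0, ∀ R : ℝ, 1 ≤ R →
      ∫ x in closedBall (0 : EuclideanSpace ℝ (Fin 3)) R, ‖v t x‖ ^ 2 ≤
        K * ((1 / (-t) + 1 + 1 / Real.sqrt (-t)) / R) *
          (volume (closedBall (0 : EuclideanSpace ℝ (Fin 3)) R)).toReal := by
  obtain ⟨K, hK0, hK⟩ := exists_integral_abs_sub_le_class_allRadii
  have hC0 : 0 ≤ C := by
    have h := hrate (-1) (by norm_num) 0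
    rw [neg_neg, Real.sqrt_one, div_one] at h
    exact (norm_nonneg _).trans h
  have hBMO : ∀ t₀ < 0, ∀ p : ℝ → EuclideanSpace ℝ (Fin 3) → ℝ, IsClassicalNSSolutionOn (Ioo t₀ 0) 1 0 v p →
      ∀ s, t₀ < s → s < 0 → ∀ R : ℝ, 0 < R → ∃ c : ℝ,
        ∫ x in closedBall (0 : EuclideanSpace ℝ (Fin 3)) R, |p s x - c| ≤
          K * C ^ 2 / (-s) * (volume (closedBall (0 : EuclideanSpace ℝ (Fin 3)) R)).toReal := by
    intro t₀ ht₀ p hcl s hs1 hs2 R hR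
    obtain ⟨κ, hκ⟩ := hK hrate hmild ht₀ hcl s hs1 hs2 R hR
    exact ⟨κ, hκ.trans (le_of_eq (by rw [measureReal_def]; ring))⟩
  exact exists_largeScale_energy_bound hrate hcont hmild hdiv (by positivity : 0 ≤ K * C ^ 2) hBMO

end Summit.NavierStokesRegularity.NavierStokesRegularity.Theorems.PoloidalWindowDoorPoloidalWindowRigidityLargeScaleEnergyHolds

end
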